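import Summits.ABC.ABC.Theorems.TwistAmplificationSharpModerateLawAbcOfDeepRegimeLaw
import Summits.ABC.ABC.Theorems.TwistAmplificationSharpModerateLawTwistedFreyInj
import Summits.ABC.ABC.Theorems.TwistAmplificationSharpModerateLawTwistedFreyFacts
import Summits.ABC.ABC.Theorems.TwistAmplificationSharpModerateLawCuspSumBound23
import Summits.ABC.ABC.Theorems.TwistAmplificationSharpModerateLawCuspSumBoundNamed

/-!
# Crux `TwistAmplification.SharpModerateLaw` (stmt-ABC-1975), line `deep-moduli-cusp-dispersion`:
the hardest stub ALONE implies the summit (summit calibration of `stub_deepRegime`)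

Lead `prover-line-stmt-ABC-1975-c2-0`, 2026-08-16 (cycle 2 of the line).  The line cuts the cusp counting
law C⁺′ into three regime laws; its hardest stub `stub_deepRegime` concludes the law on the twist-aware
DEEP regime, `LawOn DeepRegimeTw` (thick tube at every twist scale, simple radical `< Y^{1/6}`).  The
previous cycle certified `LawOn DeepRegime → MazurKaneLaw` (the route's rank-4 crux).  This file composes
the three pieces landed this cycle,

* `twistedFreyPair_inj`   — `(a, b, d) ↦ (d²·c₄(a,b), d³·c₆(a,b))` is injective on Frey–twist data
  (`…TwistedFreyInj.lean`),
* `twistedFreyPair_facts` — the twisted Frey pair is a tower-free cusp pair with `N* ≤ 2·rad(abc)·d²`,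
  simple radical `1`, level `(16(a²+ab+b²))³d⁶ ∈ [1728(cd)⁶, 4096(cd)⁶)` and twist divisors `∣ 4d`
  (`…TwistedFreyFacts.lean`),
* `abc_of_lawOn_deepRegimeTw_of_facts` — given those two facts, `LawOn DeepRegimeTw` feeds the landed
  Frey–twist amplification `FreyAmplification_proof` (window `κ = 4`, `σ = 12`; dyadic shells as in the
  transfer `stub_cuspTransfer`) and yields `ABC` (`…AbcOfDeepRegimeLaw.lean`),

into the unconditional implications

  `abc_of_lawOn_deepRegimeTw : LawOn DeepRegimeTw → ABC`     (registered sub-goal of stmt-ABC-1975),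
  `abc_of_lawOn_deepRegime   : LawOn DeepRegime   → ABC`     (the g2-typed regime, a stronger hypothesis),
  `abc_of_deepRegimeLawTw    : DeepRegimeLawTw    → ABC`     (the registered stub `stub_deepRegime` itself,
                                                              its two stationary-phase inputs being landed),

together with the named discharge `cuspSumBound23_holds : CuspSumBound23` of the now-landed stub 2′
(`stub_cuspStationaryPhase23`, `…CuspSumBound23.lean`).

WHAT THIS CERTIFIES FOR THE PLANNER.  The crux implies the summit along the route
(`SharpLawGivesWindow`, `Assembly`); C⁺′ implies the crux (`transferD`); and now the single regime stub
`stub_deepRegime` implies the summit by itself: the resolution split of the line concentrates the whole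
pointwise strength of `ABC` (via twist amplification of Frey pairs, which all lie in the deep regime:
`r' = 1`, `N* ≤ 2·rad·d²`) in that one stub.  Promoting `stub_deepRegime` to an item is therefore
re-filing the summit in cusp coordinates; no reshaping inside the line can make it smaller than `ABC`.
-/

noncomputable section

-- `Summit.<Summit>.<Problem>` is the mandated summit-side namespace (CONVENTIONS §2); for the
-- single-conjunct summit `ABC` the two coincide, so the duplicate `ABC.ABC` is deliberate.
set_option linter.dupNamespace false

namespace Summit.ABC.ABC.Theorems.SharpModerateLaw.CuspDispersion

/-- **`CuspSumBound23` holds**: the stationary-phase bound `|S(h₁,h₂;pⁿ)| ≤ 2·p^{n/2}` at `p = 2, 3`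
(`n ≥ 2`, `(h₁,h₂)` not both divisible by `p`) — the landed stub `stub_cuspStationaryPhase23`, read
through `cuspSum` (definitional unfolding). -/
theorem cuspSumBound23_holds : CuspSumBound23 := stub_cuspStationaryPhase23

/-- **The deep-regime law implies the summit.** `LawOn DeepRegimeTw → ABC`: the conclusion of the
line's hardest stub `stub_deepRegime` (the cusp counting law on the twist-aware deep regime, for every
`σ > 6` and `ε > 0`, on the cone `X³ ≤ 8Y ≤ 8X^σ`) alone implies the abc conjecture, by injecting the
Frey–twist data `(a, b, c, d)` (`d = 1` or a prime `∤ abc`) into deep-regime sets through the twisted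
Frey pairs `(d²·16(a²+ab+b²), −d³·32(b−a)(2a+b)(a+2b))` and applying the landed Frey–twist amplification
`FreyAmplification_proof` at the window `κ = 4`, `σ = 12`.  Registered sub-goal `abc_of_lawOn_deepRegimeTw`
of stmt-ABC-1975 (composition of `twistedFreyPair_inj`, `twistedFreyPair_facts`,
`abc_of_lawOn_deepRegimeTw_of_facts`). -/
theorem abc_of_lawOn_deepRegimeTw : LawOn DeepRegimeTw → _root_.ABC :=
  abc_of_lawOn_deepRegimeTw_of_facts twistedFreyPair_inj twistedFreyPair_facts

/-- The law on the g2-TYPED deep regime (`DeepRegime ⊇ DeepRegimeTw`, a stronger hypothesis) implies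
the summit as well. -/
theorem abc_of_lawOn_deepRegime (h : LawOn DeepRegime) : _root_.ABC :=
  abc_of_lawOn_deepRegimeTw (lawOn_deepRegimeTw_of_lawOn_deepRegime h)

/-- **The registered stub `stub_deepRegime` implies the summit**: `DeepRegimeLawTw =
(CuspSumBound → CuspSumBound23 → LawOn DeepRegimeTw)`, and both stationary-phase inputs are landed
(`cuspSumBound_holds`, `cuspSumBound23_holds`). -/
theorem abc_of_deepRegimeLawTw (h : DeepRegimeLawTw) : _root_.ABC :=
  abc_of_lawOn_deepRegimeTw (h cuspSumBound_holds cuspSumBound23_holds)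

/-- The g2-typed form of the stub, `DeepRegimeLaw = (CuspSumBound → LawOn DeepRegime)`, implies the
summit. -/
theorem abc_of_deepRegimeLaw (h : DeepRegimeLaw) : _root_.ABC :=
  abc_of_lawOn_deepRegime (h cuspSumBound_holds)

end Summit.ABC.ABC.Theorems.SharpModerateLaw.CuspDispersion

end
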